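import Summits.QuantumFields.YangMills.Theorems.BalabanUVNodesN07DirectMethod
import Summits.QuantumFields.YangMills.Theorems.UnitScaleTiltProp8EulerLagrangeCarrier
import Literature.MathematicalPhysics.QuantumFieldTheory.Balaban1983to89.T3PrintedMinimiserExistence
import Literature.MathematicalPhysics.QuantumFieldTheory.Balaban1983to89.BlockAveragingEMLProp2
import HarnessLib

/-!
# `AlphaInputsT3ACMinimiserPin` — THE r1-PIN LEMMA, EXISTENCE HALF: from [Balaban1985Variational] Thm 1 + Prop 7 in the GLOBAL reading AT GIVEN
# CONSTANTS (`T3PrintedMinimiserExistence.Thm1GlobalMinAt L a₀ a₁ B₃`: one minimiser PER admissible pair `(ε₁, ε₀)`), ONE configuration per datum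
# `V` serving EVERY pair of the shell `0 < ε₁ ≤ a₁`, `B₃ε₁ ≤ ε₀ ≤ a₀` — the shape of the minimiser row r1 of the (α) socket
# (`AlphaInputsT3ACv2.MinimiserRowsT3`, conjunct 1, which reads ONE value `U_{K−n}(triv, V)` for all pairs) — lane `pub-balaban3d`, seat alpha-1 (g6)

Cell `ym3-torus`, route `UnitScaleTilt`, crux 2′ `stub_laneRecordsV3` (stmt-QuantumFields-19936 ∕ -19935), strategy B of the owner's width-lever ruling
(2026-08-27): the minimiser rows of the v3 record at the TRIVIAL history are PINNED from a displayed [7] Theorem 1; located point (P1) of the seat's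
supplier table (the record quantifies the `(ε₁, ε₀)`-shell AFTER the minimiser, print's schema BEFORE) is closed here by compactness, so that the
display can be the tree's existing schema `Thm1GlobalMinAt` verbatim.
* §1 (generic torus, `SU(N)`): the `k`-fold (0.4) average is continuous at every (52)-small configuration — every intermediate level stays
  `2α₀`-small by [Balaban1985Averaging] Prop. 2, PROVED for (0.4) in `BlockAveragingEMLProp2` (pattern of `BalabanUVNodesN07DirectMethod` §2).
* §2 (d = 3 family): `D_{n,K} = fieldShift ∘ avg^{K−n}` (`T3TiltDescent.descendTo`) is continuous ON the closed plaquette classes `{∀ p, |U(∂p) − 1| ≤ θ}`,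
  `θ ≤ regThreshold(r)`, `2r` admissible; hence the CLOSED regular fibre (descent fibre ∩ `≤`-versions of both clauses of (2)) is closed and compact.
* §3 ★ `exists_uniform_regMinimiser`: `ε₀`-uniformity is monotonicity of the spaces (minimise over `ε₀ = a₀`); `ε₁`-uniformity is Cantor's
  intersection theorem for the nested non-empty compact sets «closed `(B₃ε⁽ⁱ⁾)`-regular fibre ∩ {A ≤ m}» along `ε⁽ⁱ⁾ ↓ e(V)` (largest plaquette
  deviation of `V`), under print's «`a₁` sufficiently small» in the explicit form `C₀(3)·2B₃a₁ ≤ ⅓`, `4B₃a₁ ≤ 2δ₂/(7L)²`.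
* §4 the witnesses as a family `Umin n : GaugeField (F.P n) 0 → GaugeField (F.P K) 0` and r1's text for any `U_k(·, h)` pinned to it at `triv`
  through `fieldShift` (measurable selection among these witnesses: the sequel file).
HONEST FRAMING.  Kernel theorems about the tree's own objects; NOTHING of [Balaban1985Variational] is asserted (`Thm1GlobalMinAt` stays displayed,
its located half G-K1aR-2 included).  No `def`, no `instance`, no `sorry`; count-neutral; not a claim about the continuum limit or the mass gap.
References: T. Bałaban, Commun. Math. Phys. 102 (1985) 277–309 [Balaban1985Variational], Thm 1 (6)–(8) pp. 278–279; Commun. Math. Phys. 98 (1985)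
17–51 [Balaban1985Averaging], Prop. 2 (52)–(54) p. 26; Commun. Math. Phys. 109 (1987) 249–301 [Balaban1987RG1], (0.4), (0.11) p. 253.
-/

set_option autoImplicit false

noncomputable section

namespace Summit.QuantumFields.YangMills.Theorems.MinimiserPin

open Set Filter Topology
open scoped Matrix.Norms.L2Operator
open Literature.MathematicalPhysics.QuantumFieldTheory.Balaban1983to89
open Literature.MathematicalPhysics.QuantumFieldTheory.Balaban1983to89.T3ContinuumYM3Torus
open Literature.MathematicalPhysics.QuantumFieldTheory.Balaban1983to89.T3UnitLawDensityEML (ℰp)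
open Literature.MathematicalPhysics.QuantumFieldTheory.Balaban1983to89.T3PrintedRegularMinimiser (RegPr DivSmall regFibrePr)
open Literature.MathematicalPhysics.QuantumFieldTheory.Balaban1983to89.T3PrintedMinimiserExistence
  (Thm1GlobalMinAt regFibrePr_mono plaqSmall_of_le regThreshold_mono)
open Literature.MathematicalPhysics.QuantumFieldTheory.Balaban1983to89.T3RegularMinimiser (regThreshold regFibre)
open Literature.MathematicalPhysics.QuantumFieldTheory.Balaban1983to89.T3ConstrainedMinimiser (fibre)
open Literature.MathematicalPhysics.QuantumFieldTheory.Balaban1983to89.T3TiltDescent (descendTo)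
open Literature.MathematicalPhysics.QuantumFieldTheory.Balaban1983to89.T3LevelShift (fieldShift bondShift fieldShift_fieldShift_symm)
open Literature.MathematicalPhysics.QuantumFieldTheory.Balaban1983to89.B10Eq27TorusAxialLog (toUField unitsField)
open Literature.MathematicalPhysics.QuantumFieldTheory.Balaban1983to89.B10Eq68TorusRegularity (covDivT)
open Literature.MathematicalPhysics.QuantumFieldTheory.Balaban1983to89.ExpMeanLog (expMeanLogSU deltaSU deltaSU_pos)
open Literature.MathematicalPhysics.QuantumFieldTheory.Balaban1983to89.BlockAveraging (blockAvg)
open Literature.MathematicalPhysics.QuantumFieldTheory.Balaban1983to89.BlockAveragingEMLProp2 (plaqSmall_iter_blockAvg_eml_level smallness_of_le_c2')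
open Summit.QuantumFields.YangMills.BalabanUVNodes.N07DirectMethod
  (continuous_wilsonAction4 continuous_dist1_plaqHol isCompact_of_isClosed_cfg continuousAt_avg_blockAvg_of_plaqSmall)
open Summit.QuantumFields.YangMills.Theorems.Prop8Criticality (continuous_covDivT)

/-! ## §1 Continuity of the `k`-fold (0.4) average at (52)-small configurations (generic torus, `SU(N)`) -/

section Generic

variable {N : ℕ} [NeZero N] {P : Params}

/-- The admissible-radius arithmetic of (53): `2α₀ ≤ c′₂ = 2δ_N/((d+4)L)²` ⇒ `(((d+2)L)²/4)·(2α₀) < δ_N`. [cite: Balaban1985Averaging, Prop. 1 p.26 (bookkeeping)] -/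
theorem loopRadius_lt_deltaSU {α₀ : ℝ} (hα : 0 < α₀)
    (hα2 : 2 * α₀ ≤ 2 * deltaSU (Fin N) / (((P.d + 4) * P.L : ℕ) : ℝ) ^ 2) :
    ((((P.d + 2) * P.L : ℕ) : ℝ) ^ 2 / 4) * (2 * α₀) < deltaSU (Fin N) := by
  have h1 := smallness_of_le_c2' (n := Fin N) (P := P) hα2
  have hdl : (((P.d + 2) * P.L : ℕ) : ℝ) ≤ (((P.d + 4) * P.L : ℕ) : ℝ) := by
    exact_mod_cast Nat.mul_le_mul_right _ (by omega)
  have h0 : (0 : ℝ) ≤ (((P.d + 2) * P.L : ℕ) : ℝ) := Nat.cast_nonneg _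
  have h2 : (((P.d + 2) * P.L : ℕ) : ℝ) ^ 2 ≤ (((P.d + 4) * P.L : ℕ) : ℝ) ^ 2 := by gcongr
  have hδ := deltaSU_pos (n := Fin N)
  nlinarith

/-- **EVERY INTERMEDIATE AVERAGE OF A (52)-SMALL CONFIGURATION IS `2α₀`-SMALL**: `|U(∂p) − 1| < α₀η_k²`, `α₀` admissible as in (53) ⇒
`|Ū^i(∂p) − 1| < 2α₀` for all `i ≤ k` (Proposition 2 PROVED for (0.4), the scale factor `(L^iη_k)² ≤ 1` dropped). [cite: Balaban1985Averaging, (53)–(54) p.26] -/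
theorem plaqSmall_two_iter_blockAvg (k : ℕ) {α₀ : ℝ} (hα : 0 < α₀)
    (hα3 : (143 * ((((P.d + 4 : ℕ) : ℝ)) ^ 2 / 4) ^ 2) * α₀ ≤ 1 / 3)
    (hα2 : 2 * α₀ ≤ 2 * deltaSU (Fin N) / (((P.d + 4) * P.L : ℕ) : ℝ) ^ 2)
    {U : GaugeField P 0 (Matrix.specialUnitaryGroup (Fin N) ℂ)} (h52 : PlaqSmall (α₀ * (((P.L : ℝ) ^ k)⁻¹) ^ 2) U)
    {i : ℕ} (hi : i ≤ k) :
    PlaqSmall (2 * α₀) (Averaging.iter (fun j => blockAvg (P := P) (j := j) (expMeanLogSU (n := Fin N))) i U) := by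
  have h := plaqSmall_iter_blockAvg_eml_level (n := Fin N) (P := P) k hα hα3 hα2 h52 hi
  have hL1 : (1 : ℝ) ≤ (P.L : ℝ) := by exact_mod_cast P.L_pos
  have hLk : (0 : ℝ) < (P.L : ℝ) ^ k := by positivity
  have hx1 : (P.L : ℝ) ^ i * ((P.L : ℝ) ^ k)⁻¹ ≤ 1 := by
    rw [mul_inv_le_iff₀ hLk, one_mul]
    exact pow_le_pow_right₀ hL1 hi
  have hx0 : 0 ≤ (P.L : ℝ) ^ i * ((P.L : ℝ) ^ k)⁻¹ := by positivity
  have hsq : ((P.L : ℝ) ^ i * ((P.L : ℝ) ^ k)⁻¹) ^ 2 ≤ 1 := pow_le_one₀ hx0 hx1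
  intro p
  refine (h p).trans_le ?_
  have : 0 ≤ 2 * α₀ := by positivity
  nlinarith

/-- ★ **THE `k`-FOLD (0.4) AVERAGE IS CONTINUOUS AT EVERY (52)-SMALL CONFIGURATION**, `i ≤ k`: induction on `i`, every intermediate average staying
`2α₀`-small (Prop. 2) where the one-step exp-mean-log averaging is continuous (`N07DirectMethod.continuousAt_avg_blockAvg_of_plaqSmall`).
[cite: Balaban1985Averaging, Prop. 2 (52)–(54) p.26; Balaban1987RG1, (0.4) p.253] -/
theorem continuousAt_iter_blockAvg_of_plaqSmall (k : ℕ) {α₀ : ℝ} (hα : 0 < α₀)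
    (hα3 : (143 * ((((P.d + 4 : ℕ) : ℝ)) ^ 2 / 4) ^ 2) * α₀ ≤ 1 / 3)
    (hα2 : 2 * α₀ ≤ 2 * deltaSU (Fin N) / (((P.d + 4) * P.L : ℕ) : ℝ) ^ 2)
    {U : GaugeField P 0 (Matrix.specialUnitaryGroup (Fin N) ℂ)} (h52 : PlaqSmall (α₀ * (((P.L : ℝ) ^ k)⁻¹) ^ 2) U) :
    ∀ i : ℕ, i ≤ k → ContinuousAt (Averaging.iter (fun j => blockAvg (P := P) (j := j) (expMeanLogSU (n := Fin N))) i) U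
  | 0, _ => continuousAt_id
  | i + 1, hi => by
    have hi' : i ≤ k := Nat.le_of_succ_le hi
    have hstep : ContinuousAt (blockAvg (P := P) (j := i) (expMeanLogSU (n := Fin N))).avg
        (Averaging.iter (fun j => blockAvg (P := P) (j := j) (expMeanLogSU (n := Fin N))) i U) :=
      continuousAt_avg_blockAvg_of_plaqSmall (by positivity) (plaqSmall_two_iter_blockAvg k hα hα3 hα2 h52 hi')
        (loopRadius_lt_deltaSU hα hα2)
    show ContinuousAt ((blockAvg (P := P) (j := i) (expMeanLogSU (n := Fin N))).avg ∘
      Averaging.iter (fun j => blockAvg (P := P) (j := j) (expMeanLogSU (n := Fin N))) i) U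
    exact hstep.comp (continuousAt_iter_blockAvg_of_plaqSmall k hα hα3 hα2 h52 i hi')

end Generic

/-! ## §2 The d = 3 family: continuity of the descent on the closed plaquette classes; the closed regular fibre is compact -/

section Family

variable (F : T3Family)

/-- The re-indexing `fieldShift` between towers is continuous (product topology). [cite: Balaban1987RG1, (0.1) p.251 (bookkeeping)] -/
theorem continuous_fieldShift {G : Type*} [TopologicalSpace G] {m K j m' K' j' : ℕ}
    (h : (F.PP m K).sitesPerDir j = (F.PP m' K').sitesPerDir j') :
    Continuous (fieldShift (G := G) h : GaugeField (F.PP m' K') j' G → GaugeField (F.PP m K) j G) :=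
  continuous_pi fun b => by
    show Continuous fun V : GaugeField (F.PP m' K') j' G => V (bondShift h b)
    exact continuous_apply (bondShift h b)

/-- `regThreshold(ε) = ε·((L^{K−n})⁻¹)²` (the letters of Proposition 2). [cite: Balaban1985Variational, (2) p.278 (bookkeeping)] -/
theorem regThreshold_eq (n K : ℕ) (ε : ℝ) :
    regThreshold F n K ε = ε * ((((F.P K).L : ℝ) ^ (K - n))⁻¹) ^ 2 := by
  show ε * ((F.L : ℝ)⁻¹) ^ (2 * (K - n)) = ε * (((F.L : ℝ) ^ (K - n))⁻¹) ^ 2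
  rw [← inv_pow, ← pow_mul, mul_comm (K - n) 2]

/-- **THE DESCENT `D_{n,K}` IS CONTINUOUS AT EVERY CONFIGURATION OF A SMALL CLOSED PLAQUETTE CLASS**: `|U(∂p) − 1| ≤ θ ≤ regThreshold(r)` for all
`p`, with `2r` admissible as in (53) (`C₀(3)·2r ≤ ⅓`, `4r ≤ 2δ₂/(7L)²`), ⇒ `descendTo F ℰp n K` is continuous at `U` (the `(K−n)`-fold average is, §1,
and `fieldShift` is continuous). [cite: Balaban1987RG1, (0.11) p.253; Balaban1985Averaging, Prop. 2 p.26] -/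
theorem continuousAt_descendTo_of_plaqLe (n K : ℕ) (h : n ≤ K) {r : ℝ} (hr : 0 < r)
    (hr3 : (143 * ((((3 + 4 : ℕ) : ℝ)) ^ 2 / 4) ^ 2) * (2 * r) ≤ 1 / 3)
    (hr2 : 2 * (2 * r) ≤ 2 * deltaSU (Fin 2) / (((3 + 4) * F.L : ℕ) : ℝ) ^ 2)
    {θ : ℝ} (hθ : θ ≤ regThreshold F n K r) {U : GaugeField (F.P K) 0 (Matrix.specialUnitaryGroup (Fin 2) ℂ)}
    (hU : ∀ p : Plaq (F.P K) 0, GaugeGroup.dist1 (GaugeField.plaqHol U p) ≤ θ) :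
    ContinuousAt (descendTo F ℰp n K h) U := by
  have hLk : (0 : ℝ) < (((F.P K).L : ℝ) ^ (K - n))⁻¹ := by
    have := (F.P K).L_pos
    positivity
  have h52 : PlaqSmall ((2 * r) * ((((F.P K).L : ℝ) ^ (K - n))⁻¹) ^ 2) U := by
    intro p
    refine (hU p).trans_lt (hθ.trans_lt ?_)
    rw [regThreshold_eq]
    have : 0 < ((((F.P K).L : ℝ) ^ (K - n))⁻¹) ^ 2 := by positivity
    nlinarith
  have hiter := continuousAt_iter_blockAvg_of_plaqSmall (N := 2) (P := F.P K) (K - n) (by positivity) hr3 hr2 h52 (K - n) le_rfl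
  exact (continuous_fieldShift F _).continuousAt.comp hiter

/-- The closed plaquette class `{U | ∀ p, |U(∂p) − 1| ≤ θ}` is closed. [cite: Balaban1985Variational, (2) p.278 (bookkeeping)] -/
theorem isClosed_plaqLe (K : ℕ) (θ : ℝ) :
    IsClosed {U : GaugeField (F.P K) 0 (Matrix.specialUnitaryGroup (Fin 2) ℂ) | ∀ p : Plaq (F.P K) 0, GaugeGroup.dist1 (GaugeField.plaqHol U p) ≤ θ} := by
  simp only [setOf_forall]
  exact isClosed_iInter fun p => isClosed_le (continuous_dist1_plaqHol (N := 2) p) continuous_const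

/-- The closed divergence class `{U | ∀ b, ‖(D^{1*}_U ∂U)(b)‖ ≤ θ}` is closed. [cite: Balaban1985RegularSpaces, (1.9) p.77 (bookkeeping)] -/
theorem isClosed_divLe (K : ℕ) (θ : ℝ) :
    IsClosed {U : GaugeField (F.P K) 0 (Matrix.specialUnitaryGroup (Fin 2) ℂ) |
      ∀ b : PBond (F.P K) 0, ‖covDivT 1 (unitsField (toUField U)) b.dir b.src‖ ≤ θ} := by
  simp only [setOf_forall]
  exact isClosed_iInter fun b => isClosed_le (continuous_covDivT b.dir b.src).norm continuous_const

/-- The sublevel set `{U | A(U) ≤ m}` of the Wilson action is closed. [cite: Balaban1985Variational, (5) p.278 (bookkeeping)] -/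
theorem isClosed_actionLe (K : ℕ) (m : ℝ) :
    IsClosed {U : GaugeField (F.P K) 0 (Matrix.specialUnitaryGroup (Fin 2) ℂ) | wilsonAction4 U ≤ m} :=
  isClosed_le (continuous_wilsonAction4 (N := 2)) continuous_const

/-- **THE CLOSED REGULAR FIBRE IS CLOSED**: `{D_{n,K}U = V} ∩ {|U(∂p) − 1| ≤ regThreshold(ε)} ∩ {‖D*∂U‖ ≤ ε·L^{−3(K−n)}}` for `0 ≤ ε ≤ r`, `2r` admissible
(the descent is continuous on the closed plaquette class, so the fibre meets it in a closed set). [cite: Balaban1985Variational, (2), (3), (6) p.278] -/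
theorem isClosed_closedRegFibre (n K : ℕ) (h : n ≤ K) {r : ℝ} (hr : 0 < r)
    (hr3 : (143 * ((((3 + 4 : ℕ) : ℝ)) ^ 2 / 4) ^ 2) * (2 * r) ≤ 1 / 3)
    (hr2 : 2 * (2 * r) ≤ 2 * deltaSU (Fin 2) / (((3 + 4) * F.L : ℕ) : ℝ) ^ 2)
    {ε : ℝ} (hε : ε ≤ r) (V : GaugeField (F.P n) 0 (Matrix.specialUnitaryGroup (Fin 2) ℂ)) :
    IsClosed ({U : GaugeField (F.P K) 0 (Matrix.specialUnitaryGroup (Fin 2) ℂ) | ∀ p : Plaq (F.P K) 0,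
        GaugeGroup.dist1 (GaugeField.plaqHol U p) ≤ regThreshold F n K ε} ∩ descendTo F ℰp n K h ⁻¹' {V} ∩
      {U | ∀ b : PBond (F.P K) 0, ‖covDivT 1 (unitsField (toUField U)) b.dir b.src‖ ≤ ε * ((F.L : ℝ)⁻¹) ^ (3 * (K - n))}) := by
  haveI : T2Space (GaugeField (F.P n) 0 (Matrix.specialUnitaryGroup (Fin 2) ℂ)) :=
    inferInstanceAs (T2Space (PBond (F.P n) 0 → Matrix.specialUnitaryGroup (Fin 2) ℂ))
  refine IsClosed.inter ?_ (isClosed_divLe F K _)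
  have hcont : ContinuousOn (descendTo F ℰp n K h) {U : GaugeField (F.P K) 0 (Matrix.specialUnitaryGroup (Fin 2) ℂ) |
      ∀ p : Plaq (F.P K) 0, GaugeGroup.dist1 (GaugeField.plaqHol U p) ≤ regThreshold F n K ε} :=
    fun _ hU => (continuousAt_descendTo_of_plaqLe F n K h hr hr3 hr2 (regThreshold_mono F hε) hU).continuousWithinAt
  exact hcont.preimage_isClosed_of_isClosed (isClosed_plaqLe F K _) isClosed_singleton

end Family

/-! ## §3 ★ One minimiser for the whole `(ε₁, ε₀)`-shell -/

section Uniform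

variable (F : T3Family)

/-- The largest plaquette deviation `e(V) = max_p |V(∂p) − 1|` bounds every plaquette (finite supremum; `0` on a torus without plaquettes).
[cite: Balaban1985Variational, (7) p.278 (bookkeeping)] -/
theorem dist1_le_iSup {n : ℕ} (V : GaugeField (F.P n) 0 (Matrix.specialUnitaryGroup (Fin 2) ℂ)) (p : Plaq (F.P n) 0) :
    GaugeGroup.dist1 (GaugeField.plaqHol V p) ≤ ⨆ q : Plaq (F.P n) 0, GaugeGroup.dist1 (GaugeField.plaqHol V q) :=
  le_ciSup (f := fun q : Plaq (F.P n) 0 => GaugeGroup.dist1 (GaugeField.plaqHol V q)) (Set.finite_range _).bddAbove p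

/-- `0 ≤ e(V)`. [cite: Balaban1985Variational, (7) p.278 (bookkeeping)] -/
theorem iSup_dist1_nonneg {n : ℕ} (V : GaugeField (F.P n) 0 (Matrix.specialUnitaryGroup (Fin 2) ℂ)) :
    0 ≤ ⨆ q : Plaq (F.P n) 0, GaugeGroup.dist1 (GaugeField.plaqHol V q) := by
  rcases isEmpty_or_nonempty (Plaq (F.P n) 0) with hE | hN
  · rw [Real.iSup_of_isEmpty]
  · exact Real.iSup_nonneg fun q => GaugeGroup.dist1_nonneg _

/-- `|V(∂p) − 1| < ε` for all `p` and `0 < ε` ⇒ `e(V) < ε` (the supremum is attained or the torus has no plaquettes). [cite: Balaban1985Variational, (7) p.278 (bookkeeping)] -/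
theorem iSup_dist1_lt_of_plaqSmall {n : ℕ} (V : GaugeField (F.P n) 0 (Matrix.specialUnitaryGroup (Fin 2) ℂ)) {ε : ℝ} (hε : 0 < ε)
    (hV : PlaqSmall ε V) : (⨆ q : Plaq (F.P n) 0, GaugeGroup.dist1 (GaugeField.plaqHol V q)) < ε := by
  rcases isEmpty_or_nonempty (Plaq (F.P n) 0) with hE | hN
  · rwa [Real.iSup_of_isEmpty]
  · obtain ⟨q, hq⟩ := exists_eq_ciSup_of_finite (f := fun q : Plaq (F.P n) 0 => GaugeGroup.dist1 (GaugeField.plaqHol V q))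
    rw [← hq]
    exact hV q

/-- `e(V) < ε` ⇒ `|V(∂p) − 1| < ε` for all `p`. [cite: Balaban1985Variational, (7) p.278 (bookkeeping)] -/
theorem plaqSmall_of_iSup_dist1_lt {n : ℕ} (V : GaugeField (F.P n) 0 (Matrix.specialUnitaryGroup (Fin 2) ℂ)) {ε : ℝ}
    (hV : (⨆ q : Plaq (F.P n) 0, GaugeGroup.dist1 (GaugeField.plaqHol V q)) < ε) : PlaqSmall ε V :=
  fun p => (dist1_le_iSup F V p).trans_lt hV

/-- ★★ **THE r1-PIN LEMMA, EXISTENCE HALF — ONE MINIMISER FOR THE WHOLE SHELL.**  Assume [Balaban1985Variational] Thm 1 + Prop 7 in the global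
reading at the constants `(a₀, a₁, B₃)` for block size `F.L` (`Thm1GlobalMinAt`), `0 < B₃`, `B₃a₁ ≤ a₀`, and `a₁` small in the sense of
[Balaban1985Averaging] (53) for the radius `2B₃a₁` (`C₀(3)·2B₃a₁ ≤ ⅓`, `4B₃a₁ ≤ 2δ₂/(7L)²`).  Then for every `n < K` and every datum `V` on the
`n`-th approximation's finest lattice there is ONE configuration `U` of run `K` such that for EVERY pair `0 < ε₁ ≤ a₁`, `B₃ε₁ ≤ ε₀ ≤ a₀` with
`|V(∂p) − 1| < ε₁`: `U ∈ regFibrePr (B₃ε₁) V` (the space (8)) and `U` minimises the Wilson action over `regFibrePr ε₀ V` (the space (6)).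
[cite: Balaban1985Variational, Thm 1 (6)–(8) pp.278–279; Balaban1985Averaging, Prop. 2 (52)–(54) p.26] -/
theorem exists_uniform_regMinimiser {a₀ a₁ B₃ : ℝ} (hT : Thm1GlobalMinAt F.L a₀ a₁ B₃) (hB₃ : 0 < B₃) (hwin : B₃ * a₁ ≤ a₀)
    (hA3 : (143 * ((((3 + 4 : ℕ) : ℝ)) ^ 2 / 4) ^ 2) * (2 * (B₃ * a₁)) ≤ 1 / 3)
    (hA2 : 2 * (2 * (B₃ * a₁)) ≤ 2 * deltaSU (Fin 2) / (((3 + 4) * F.L : ℕ) : ℝ) ^ 2)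
    (n K : ℕ) (hnK : n < K) (V : GaugeField (F.P n) 0 (Matrix.specialUnitaryGroup (Fin 2) ℂ)) :
    ∃ U : GaugeField (F.P K) 0 (Matrix.specialUnitaryGroup (Fin 2) ℂ),
      ∀ ε₁ ε₀ : ℝ, 0 < ε₁ → ε₁ ≤ a₁ → B₃ * ε₁ ≤ ε₀ → ε₀ ≤ a₀ → PlaqSmall ε₁ V →
        U ∈ regFibrePr F n K hnK.le (B₃ * ε₁) V ∧
          IsMinOn (fun W : GaugeField (F.P K) 0 (Matrix.specialUnitaryGroup (Fin 2) ℂ) => wilsonAction4 W) (regFibrePr F n K hnK.le ε₀ V) U := by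
  classical
  -- the shell of `V`: empty unless some admissible `ε₁` bounds the plaquettes of `V`
  by_cases hsh : ∃ ε₁ : ℝ, 0 < ε₁ ∧ ε₁ ≤ a₁ ∧ PlaqSmall ε₁ V
  swap
  · exact ⟨1, fun ε₁ ε₀ h₁ h₂ _ _ h₅ => absurd ⟨ε₁, h₁, h₂, h₅⟩ hsh⟩
  obtain ⟨ε', hε'0, hε'a, hε'V⟩ := hsh
  -- the largest plaquette deviation `e` of the datum: `0 ≤ e < a₁`
  set e : ℝ := ⨆ q : Plaq (F.P n) 0, GaugeGroup.dist1 (GaugeField.plaqHol V q) with he_def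
  have he0 : 0 ≤ e := iSup_dist1_nonneg F V
  have hea : e < a₁ := (iSup_dist1_lt_of_plaqSmall F V hε'0 hε'V).trans_le hε'a
  have ha₁ : 0 < a₁ := hε'0.trans_le hε'a
  have hr : 0 < B₃ * a₁ := mul_pos hB₃ ha₁
  -- a sequence `ε⁽ⁱ⁾ ↓ e` inside `(e, a₁)`
  set εs : ℕ → ℝ := fun i => e + (a₁ - e) / ((i : ℝ) + 2) with hεs_def
  have hgap : 0 < a₁ - e := sub_pos.mpr hea
  have hεs_gt : ∀ i, e < εs i := fun i => by
    have : 0 < (a₁ - e) / ((i : ℝ) + 2) := div_pos hgap (by positivity)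
    simp only [hεs_def]; linarith
  have hεs_pos : ∀ i, 0 < εs i := fun i => he0.trans_lt (hεs_gt i)
  have hεs_le : ∀ i, εs i ≤ a₁ := fun i => by
    have h2 : (2 : ℝ) ≤ (i : ℝ) + 2 := by have := (Nat.cast_nonneg i : (0 : ℝ) ≤ i); linarith
    have : (a₁ - e) / ((i : ℝ) + 2) ≤ (a₁ - e) / 2 := div_le_div_of_nonneg_left hgap.le (by norm_num) h2
    simp only [hεs_def]; linarith
  have hεs_anti : ∀ i, εs (i + 1) ≤ εs i := fun i => by
    have : (a₁ - e) / (((i + 1 : ℕ) : ℝ) + 2) ≤ (a₁ - e) / ((i : ℝ) + 2) :=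
      div_le_div_of_nonneg_left hgap.le (by positivity) (by push_cast; linarith)
    simp only [hεs_def]; linarith
  have hεs_ev : ∀ ε₁ : ℝ, e < ε₁ → ∃ i, εs i < ε₁ := fun ε₁ hε₁ => by
    obtain ⟨i, hi⟩ := exists_nat_gt ((a₁ - e) / (ε₁ - e))
    refine ⟨i, ?_⟩
    have hpos : 0 < ε₁ - e := sub_pos.mpr hε₁
    have h1 : (a₁ - e) / ((i : ℝ) + 2) < ε₁ - e := by
      rw [div_lt_iff₀ (by positivity)]
      have := (div_lt_iff₀ hpos).mp hi
      nlinarith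
    simp only [hεs_def]; linarith
  -- Thm 1 at each `(ε⁽ⁱ⁾, a₀)`: a minimiser over the largest space, lying in the space (8) at `B₃ε⁽ⁱ⁾`
  have hmin : ∀ i, ∃ U ∈ regFibrePr F n K hnK.le (B₃ * εs i) V,
      IsMinOn (fun W : GaugeField (F.P K) 0 (Matrix.specialUnitaryGroup (Fin 2) ℂ) => wilsonAction4 W) (regFibrePr F n K hnK.le a₀ V) U :=
    fun i => hT F rfl n K hnK (εs i) a₀ (hεs_pos i) (hεs_le i)
      ((mul_le_mul_of_nonneg_left (hεs_le i) hB₃.le).trans hwin) le_rfl V (plaqSmall_of_iSup_dist1_lt F V (hεs_gt i))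
  choose Us hUs_mem hUs_min using hmin
  -- all these minimisers have the same action `m`
  set m : ℝ := wilsonAction4 (Us 0) with hm_def
  have hBεa : ∀ i, B₃ * εs i ≤ a₀ := fun i => (mul_le_mul_of_nonneg_left (hεs_le i) hB₃.le).trans hwin
  have hUs_le : ∀ i, wilsonAction4 (Us i) ≤ m := fun i =>
    hUs_min i (regFibrePr_mono F (hBεa 0) V (hUs_mem 0))
  -- the nested closed sets: closed `(B₃ε⁽ⁱ⁾)`-regular fibre ∩ {A ≤ m}
  set t : ℕ → Set (GaugeField (F.P K) 0 (Matrix.specialUnitaryGroup (Fin 2) ℂ)) := fun i =>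
    ({U | ∀ p : Plaq (F.P K) 0, GaugeGroup.dist1 (GaugeField.plaqHol U p) ≤ regThreshold F n K (B₃ * εs i)} ∩
        descendTo F ℰp n K hnK.le ⁻¹' {V} ∩
      {U | ∀ b : PBond (F.P K) 0, ‖covDivT 1 (unitsField (toUField U)) b.dir b.src‖ ≤ (B₃ * εs i) * ((F.L : ℝ)⁻¹) ^ (3 * (K - n))}) ∩
    {U | wilsonAction4 U ≤ m} with ht_def
  have hLpow : 0 < ((F.L : ℝ)⁻¹) ^ (3 * (K - n)) := by
    have := F.hL.2
    have hL : (0 : ℝ) < F.L := by exact_mod_cast (by omega : 0 < F.L)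
    positivity
  have ht_mem : ∀ i, Us i ∈ t i := fun i => by
    obtain ⟨⟨hfib, hplaq⟩, hdiv⟩ := hUs_mem i
    exact ⟨⟨⟨fun p => (hplaq p).le, hfib⟩, fun b => (hdiv b).le⟩, hUs_le i⟩
  have ht_anti : ∀ i, t (i + 1) ⊆ t i := fun i U hU => by
    obtain ⟨⟨⟨hplaq, hfib⟩, hdiv⟩, hact⟩ := hU
    have hBε : B₃ * εs (i + 1) ≤ B₃ * εs i := mul_le_mul_of_nonneg_left (hεs_anti i) hB₃.le
    refine ⟨⟨⟨fun p => (hplaq p).trans (regThreshold_mono F hBε), hfib⟩, fun b => (hdiv b).trans ?_⟩, hact⟩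
    exact mul_le_mul_of_nonneg_right hBε hLpow.le
  have ht_closed : ∀ i, IsClosed (t i) := fun i =>
    (isClosed_closedRegFibre F n K hnK.le hr hA3 hA2 (mul_le_mul_of_nonneg_left (hεs_le i) hB₃.le) V).inter
      (isClosed_actionLe F K m)
  have ht_cpt : IsCompact (t 0) := isCompact_of_isClosed_cfg (N := 2) (ht_closed 0)
  obtain ⟨U, hU⟩ := IsCompact.nonempty_iInter_of_sequence_nonempty_isCompact_isClosed t ht_anti (fun i => ⟨Us i, ht_mem i⟩)
    ht_cpt ht_closed
  refine ⟨U, fun ε₁ ε₀ hε₁ _ hBε hε₀ hV => ?_⟩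
  -- pick `i` with `ε⁽ⁱ⁾ < ε₁`: the `≤`-clauses at `B₃ε⁽ⁱ⁾` are strict at `B₃ε₁`
  obtain ⟨i, hi⟩ := hεs_ev ε₁ (iSup_dist1_lt_of_plaqSmall F V hε₁ hV)
  obtain ⟨⟨⟨hplaq, hfib⟩, hdiv⟩, hact⟩ := mem_iInter.mp hU i
  have hBlt : B₃ * εs i < B₃ * ε₁ := mul_lt_mul_of_pos_left hi hB₃
  have hthr : regThreshold F n K (B₃ * εs i) < regThreshold F n K (B₃ * ε₁) := by
    rw [regThreshold_eq, regThreshold_eq]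
    have : 0 < ((((F.P K).L : ℝ) ^ (K - n))⁻¹) ^ 2 := by
      have := (F.P K).L_pos
      positivity
    exact mul_lt_mul_of_pos_right hBlt this
  have hmem : U ∈ regFibrePr F n K hnK.le (B₃ * ε₁) V :=
    ⟨⟨hfib, fun p => (hplaq p).trans_lt hthr⟩, fun b => (hdiv b).trans_lt (mul_lt_mul_of_pos_right hBlt hLpow)⟩
  refine ⟨hmem, fun W hW => ?_⟩
  -- `A(U) ≤ m = A(U₀) ≤ A(W)` for every `W` in the space (6) at `ε₀ ≤ a₀`
  show wilsonAction4 U ≤ wilsonAction4 W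
  have h0W : wilsonAction4 (Us 0) ≤ wilsonAction4 W := hUs_min 0 (regFibrePr_mono F hε₀ V hW)
  exact hact.trans h0W

end Uniform

/-! ## §4 The witnesses as a family over the data, read at the record's letters -/

section Pin

variable (F : T3Family)

/-- ★ **THE r1 WITNESS FAMILY**: under the hypotheses of `exists_uniform_regMinimiser`, for every run `K` there is a family
`Umin : (n : ℕ) → GaugeField (F.P n) 0 → GaugeField (F.P K) 0` such that for every `n < K`, every admissible `(ε₁, ε₀)` and every `ε₁`-small `V`,
`Umin n V` lies in the space (8) at `B₃ε₁` and minimises the Wilson action over the space (6) at `ε₀` — the two clauses of the record's minimiser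
row r1 (`AlphaInputsT3ACv2.MinimiserRowsT3`, conjunct 1) for ANY composite-minimiser family `U_k(·, h)` with
`U_{K−n}(fieldShift V, triv) = Umin n V`. [cite: Balaban1985Variational, Thm 1 (6)–(8) pp.278–279] -/
theorem exists_uminFamily {a₀ a₁ B₃ : ℝ} (hT : Thm1GlobalMinAt F.L a₀ a₁ B₃) (hB₃ : 0 < B₃) (hwin : B₃ * a₁ ≤ a₀)
    (hA3 : (143 * ((((3 + 4 : ℕ) : ℝ)) ^ 2 / 4) ^ 2) * (2 * (B₃ * a₁)) ≤ 1 / 3)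
    (hA2 : 2 * (2 * (B₃ * a₁)) ≤ 2 * deltaSU (Fin 2) / (((3 + 4) * F.L : ℕ) : ℝ) ^ 2) (K : ℕ) :
    ∃ Umin : (n : ℕ) → GaugeField (F.P n) 0 (Matrix.specialUnitaryGroup (Fin 2) ℂ) →
        GaugeField (F.P K) 0 (Matrix.specialUnitaryGroup (Fin 2) ℂ),
      ∀ (n : ℕ) (hnK : n < K) (ε₁ ε₀ : ℝ), 0 < ε₁ → ε₁ ≤ a₁ → B₃ * ε₁ ≤ ε₀ → ε₀ ≤ a₀ →
        ∀ V : GaugeField (F.P n) 0 (Matrix.specialUnitaryGroup (Fin 2) ℂ), PlaqSmall ε₁ V →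
          Umin n V ∈ regFibrePr F n K hnK.le (B₃ * ε₁) V ∧
            IsMinOn (fun W : GaugeField (F.P K) 0 (Matrix.specialUnitaryGroup (Fin 2) ℂ) => wilsonAction4 W)
              (regFibrePr F n K hnK.le ε₀ V) (Umin n V) := by
  classical
  have key : ∀ (n : ℕ) (V : GaugeField (F.P n) 0 (Matrix.specialUnitaryGroup (Fin 2) ℂ)),
      ∃ U : GaugeField (F.P K) 0 (Matrix.specialUnitaryGroup (Fin 2) ℂ), ∀ (hnK : n < K) (ε₁ ε₀ : ℝ),
        0 < ε₁ → ε₁ ≤ a₁ → B₃ * ε₁ ≤ ε₀ → ε₀ ≤ a₀ → PlaqSmall ε₁ V →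
          U ∈ regFibrePr F n K hnK.le (B₃ * ε₁) V ∧
            IsMinOn (fun W : GaugeField (F.P K) 0 (Matrix.specialUnitaryGroup (Fin 2) ℂ) => wilsonAction4 W)
              (regFibrePr F n K hnK.le ε₀ V) U := by
    intro n V
    by_cases hnK : n < K
    · obtain ⟨U, hU⟩ := exists_uniform_regMinimiser F hT hB₃ hwin hA3 hA2 n K hnK V
      exact ⟨U, fun _ ε₁ ε₀ h₁ h₂ h₃ h₄ h₅ => hU ε₁ ε₀ h₁ h₂ h₃ h₄ h₅⟩
    · exact ⟨1, fun h => absurd h hnK⟩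
  choose Umin hUmin using key
  exact ⟨Umin, fun n hnK ε₁ ε₀ h₁ h₂ h₃ h₄ V hV => hUmin n V hnK ε₁ ε₀ h₁ h₂ h₃ h₄ hV⟩

end Pin

end Summit.QuantumFields.YangMills.Theorems.MinimiserPin

end
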